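import Summits.Ventures.YMGap.RobustBall.ZTwoLayerGraph
import Literature.Probability.RandomPlanarGeometry.SAWWordsZd
import Literature.Probability.RandomPlanarGeometry.BDGS2012CountBoundsProofs
import Mathlib.Analysis.SpecificLimits.Basic
import HarnessLib

/-!
# RobustBall/LayerPathSAWCount — paths in a layer of the discrete torus are counted by the self-avoiding walks of `ℤⁿ`

HONEST FRAMING: venture file of the cell `pub-ymgap` (QuantumFields programme), track Y2 ROBUST-BALL / DS seat ds-4 (g13).  Pure combinatorics of the
layer graph `layerGraph i H` of the torus `(ℤ/L)^{n+1}` (`ZTwoLayerGraph.lean`: the sites of the selected `i`-layers, adjacent iff they differ by `± e_v`,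
`v ≠ i`); nothing about gauge fields here.  WHAT: (1) **`card_layerPaths_le_count`** — for `n ≥ 1`, all sites `a, z` and every `ℓ`, the paths
(`SimpleGraph.Walk.IsPath`) of length `ℓ` from `a` to `z` number at most `c_ℓ(ℤⁿ) = SAW.Zd.count n ℓ`: the STEP WORD of a path (letters `(v, ±)` read
off the edges through `Fin.succAbove i`) is a self-avoiding word of `ℤⁿ` (`SAW.Zd.Word.sawWords`, `card_sawWords = c_ℓ`), because the `k`-th vertex is
the start moved by the `k`-th lifted position reduced mod `L` (`layerWalk_getVert_eq`), and a path is determined by its word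
(`Walk.ext_getVert_le_length`); (2) **`sum_layerPaths_pow_le`** — for every counting certificate `c_ℓ(ℤⁿ) ≤ A·λ^ℓ`, `0 ≤ t`, `r = λ t < 1`:
`∑_{paths a → z, |p| < N} t^{|p|} ≤ A · r^{dist_j(z,a)} / (1 − r)` (paths are at least `dist_j` long); (3) the elementary certificate
`count_le_nonreversing : c_ℓ(ℤⁿ) ≤ (2n/(2n−1))·(2n−1)^ℓ` (tree `count_succ_le`, walks without immediate reversals).  Used by `CentreBlindSAWRate.lean`
(Fisher's inequality on the layer graph ⇒ explicit-rate area law of the SU(2) centre-blind class from any SAW-counting certificate).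
HONEST LABEL: finite combinatorics; nothing continuum / spectral / Clay.

References: N. Madras, G. Slade, *The Self-Avoiding Walk* (1993), §1.1–1.2 [MadrasSlade1993].
-/

noncomputable section

open Finset
open Literature.MathematicalPhysics.QuantumFieldTheory
open Literature.Probability.RandomPlanarGeometry.SAW.Zd (count)

namespace Summit.Ventures.YMGap.RobustBall

open ZN ZNFluxW

variable {n L : ℕ} [NeZero L]

namespace ZTwo

/-! ### Paths in a layer of the torus lift to self-avoiding walks of `ℤⁿ` -/

/-- Adjacent sites of the layer graph `layerGraph i H` of `(ℤ/L)^{n+1}` differ by the image `± e_{i.succAbove a}` of a step `(a, ±)` of `ℤⁿ`.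
[folklore] -/
theorem exists_letter_of_adj {i : Fin (n + 1)} {H : Finset (ZMod L)} {y y' : Site (n + 1) L} (h : (layerGraph i H).Adj y y') :
    ∃ a : Fin n × Bool, y' = y + Pi.single (i.succAbove a.1) (if a.2 then (1 : ZMod L) else -1) := by
  obtain ⟨v, hv, ε, hε, rfl⟩ := exists_single_of_adj h
  obtain ⟨m, rfl⟩ := Fin.exists_succAbove_eq hv
  by_cases h1 : ε = 1
  · exact ⟨(m, true), by simp [h1]⟩
  · exact ⟨(m, false), by simp [hε.resolve_left h1]⟩

omit [NeZero L] in
/-- The transverse coordinates of the torus image of a step of `ℤⁿ`: `(± e_{i.succAbove a})_{i.succAbove m} = (stepVec (a, ±))_m (mod L)`. [folklore] -/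
theorem single_succAbove_apply_eq_cast_stepVec (i : Fin (n + 1)) (l : Fin n × Bool) (m : Fin n) :
    (Pi.single (i.succAbove l.1) (if l.2 then (1 : ZMod L) else -1) : Site (n + 1) L) (i.succAbove m) =
      ((Literature.Probability.Percolation.stepVec l m : ℤ) : ZMod L) := by
  obtain ⟨v, b⟩ := l
  by_cases hm : m = v
  · subst hm; cases b <;> simp [Literature.Probability.Percolation.stepVec]
  · have h' : i.succAbove m ≠ i.succAbove v := fun h => hm (Fin.succAbove_right_injective h)
    cases b <;> simp [Literature.Probability.Percolation.stepVec, Pi.single_eq_of_ne h', Pi.single_eq_of_ne hm]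

/-- **Reconstruction of a layer walk from its step word.**  Given any choice `letter y y'` of steps explaining the edges of the layer graph, the
`k`-th vertex of a walk `p : a → z` is `a` moved, in the transverse coordinates, by the `k`-th vertex `traj w k` of the walk of `ℤⁿ` with step word
`w = [letter(p₀,p₁), letter(p₁,p₂), …]`, and has the same `i`-th coordinate as `a`. [folklore] -/
theorem layerWalk_getVert_eq (i : Fin (n + 1)) (H : Finset (ZMod L)) (letter : Site (n + 1) L → Site (n + 1) L → Fin n × Bool)
    (hletter : ∀ y y', (layerGraph i H).Adj y y' →
      y' = y + Pi.single (i.succAbove (letter y y').1) (if (letter y y').2 then (1 : ZMod L) else -1))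
    {a z : Site (n + 1) L} (p : (layerGraph i H).Walk a z) {k : ℕ} (hk : k ≤ p.length) :
    (∀ m : Fin n, p.getVert k (i.succAbove m) = a (i.succAbove m) +
        ((Literature.Probability.RandomPlanarGeometry.SAW.Zd.Word.traj
          (List.ofFn fun q : Fin p.length => letter (p.getVert q) (p.getVert (q + 1))) k m : ℤ) : ZMod L)) ∧
      p.getVert k i = a i := by
  induction k with
  | zero => simp
  | succ k ih =>
    have hk' : k < p.length := hk
    obtain ⟨ih1, ih2⟩ := ih hk'.le
    have hstep := hletter _ _ (p.adj_getVert_succ hk')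
    set w := List.ofFn (fun q : Fin p.length => letter (p.getVert q) (p.getVert (q + 1))) with hw
    have hwlen : w.length = p.length := by simp [hw]
    have hkw : k < w.length := by rw [hwlen]; exact hk'
    have htr := Literature.Probability.RandomPlanarGeometry.SAW.Zd.Word.traj_succ w hkw
    have hwk : w[k] = letter (p.getVert k) (p.getVert (k + 1)) := by simp [hw, List.getElem_ofFn]
    refine ⟨fun m => ?_, ?_⟩
    · rw [hstep, htr, hwk, Pi.add_apply, ih1 m, Pi.add_apply, Int.cast_add, add_assoc, single_succAbove_apply_eq_cast_stepVec]
    · rw [hstep, Pi.add_apply, ih2, Pi.single_eq_of_ne (Fin.succAbove_ne i _).symm, add_zero]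

/-- A `1`-Lipschitz height vanishing at the endpoint is at most the length of the walk. [folklore] -/
theorem height_le_length {V : Type*} {G : SimpleGraph V} (ℓ : V → ℕ) (hℓ : ∀ x y, G.Adj x y → ℓ x ≤ ℓ y + 1) {a z : V}
    (p : G.Walk a z) (hz : ℓ z = 0) : ℓ a ≤ p.length := by
  induction p with
  | nil => simp [hz]
  | cons h p ih =>
    have h1 := hℓ _ _ h
    have h2 := ih hz
    rw [SimpleGraph.Walk.length_cons]
    omega

/-- **PATHS IN A LAYER OF THE TORUS ARE COUNTED BY THE SELF-AVOIDING WALKS OF `ℤⁿ`** (`n ≥ 1`): for all sites `a, z` of `(ℤ/L)^{n+1}` and every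
`ℓ`, the paths of length `ℓ` from `a` to `z` in `layerGraph i H` number at most `c_ℓ(ℤⁿ) = SAW.Zd.count n ℓ` — the step word of a path is a
self-avoiding word of `ℤⁿ` (two times with the same lifted position have the same vertex, `layerWalk_getVert_eq`), and a path is determined by its
step word. [cite: MadrasSlade1993, §1.2 (c_N counts N-step self-avoiding walks)] -/
theorem card_layerPaths_le_count (hn : 1 ≤ n) (i : Fin (n + 1)) (H : Finset (ZMod L)) (a z : Site (n + 1) L) (ℓ : ℕ) :
    (((layerGraph i H).finsetWalkLength ℓ a z).filter fun p => p.IsPath).card ≤ count n ℓ := by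
  classical
  have hex : ∀ y y' : Site (n + 1) L, ∃ l : Fin n × Bool, (layerGraph i H).Adj y y' →
      y' = y + Pi.single (i.succAbove l.1) (if l.2 then (1 : ZMod L) else -1) := by
    intro y y'
    by_cases h : (layerGraph i H).Adj y y'
    · obtain ⟨l, hl⟩ := exists_letter_of_adj h
      exact ⟨l, fun _ => hl⟩
    · exact ⟨(⟨0, hn⟩, true), fun h' => absurd h' h⟩
  choose letter hletter using hex
  -- the step word of a walk and the reconstruction of its vertices
  let word : (layerGraph i H).Walk a z → List (Fin n × Bool) := fun p =>
    List.ofFn fun q : Fin p.length => letter (p.getVert q) (p.getVert (q + 1))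
  have hlen : ∀ p, (word p).length = p.length := fun p => by simp [word]
  have hvert : ∀ (p q : (layerGraph i H).Walk a z) (k k' : ℕ), k ≤ p.length → k' ≤ q.length →
      Literature.Probability.RandomPlanarGeometry.SAW.Zd.Word.traj (word p) k =
        Literature.Probability.RandomPlanarGeometry.SAW.Zd.Word.traj (word q) k' → p.getVert k = q.getVert k' := by
    intro p q k k' hk hk' h
    obtain ⟨h1, h2⟩ := layerWalk_getVert_eq i H letter hletter p hk
    obtain ⟨h1', h2'⟩ := layerWalk_getVert_eq i H letter hletter q hk'
    funext v
    rcases Fin.eq_self_or_eq_succAbove i v with rfl | ⟨m, rfl⟩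
    · rw [h2, h2']
    · rw [h1 m, h1' m, h]
  rw [← Literature.Probability.RandomPlanarGeometry.SAW.Zd.Word.card_sawWords n ℓ]
  refine Finset.card_le_card_of_injOn word ?_ ?_
  · intro p hp
    rw [Finset.mem_coe, Finset.mem_filter, SimpleGraph.mem_finsetWalkLength_iff] at hp
    obtain ⟨hpl, hpath⟩ := hp
    rw [Finset.mem_coe, Literature.Probability.RandomPlanarGeometry.SAW.Zd.Word.mem_sawWords]
    refine ⟨by rw [hlen, hpl], ?_⟩
    rw [Literature.Probability.RandomPlanarGeometry.SAW.Zd.Word.isSAW_iff_injOn]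
    intro k hk k' hk' hkk'
    simp only [Set.mem_setOf_eq, hlen] at hk hk'
    exact hpath.getVert_injOn (by simpa using hk) (by simpa using hk') (hvert p p k k' hk hk' hkk')
  · intro p hp q hq hpq
    rw [Finset.mem_coe, Finset.mem_filter, SimpleGraph.mem_finsetWalkLength_iff] at hp hq
    have hl : p.length = q.length := hp.1.trans hq.1.symm
    refine SimpleGraph.Walk.ext_getVert_le_length hl fun k hk => ?_
    exact hvert p q k k hk (hl ▸ hk) (by rw [hpq])

/-- **WEIGHTED PATH SUM OF A LAYER THROUGH A COUNTING CERTIFICATE OF `ℤⁿ`** (`n ≥ 1`): if `c_ℓ(ℤⁿ) ≤ A·λ^ℓ` for all `ℓ`, `0 ≤ t` and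
`r = λ t < 1`, then `∑_{paths a → z, |p| < N} t^{|p|} ≤ A · r^{dist_j(z, a)} / (1 − r)` in `layerGraph i H` (paths from `a` to `z` have length
`≥ dist_j(z, a)`, and those of length `ℓ` number `≤ c_ℓ(ℤⁿ)`). [cite: MadrasSlade1993, §1.2] -/
theorem sum_layerPaths_pow_le (hn : 1 ≤ n) (i j : Fin (n + 1)) (H : Finset (ZMod L)) {A lam t : ℝ} (hA : 0 ≤ A) (hlam : 0 ≤ lam)
    (ht : 0 ≤ t) (hr : lam * t < 1) (hcount : ∀ ℓ, (count n ℓ : ℝ) ≤ A * lam ^ ℓ) (a z : Site (n + 1) L) (N : ℕ) :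
    ∑ p ∈ ((layerGraph i H).finsetWalkLengthLT N a z).filter (fun p => p.IsPath), t ^ p.length ≤
      A * (lam * t) ^ jDist j z a / (1 - lam * t) := by
  classical
  set S := ((layerGraph i H).finsetWalkLengthLT N a z).filter (fun p => p.IsPath) with hS
  set D := jDist j z a with hD
  set r := lam * t with hrdef
  have hr0 : 0 ≤ r := mul_nonneg hlam ht
  have h1r : 0 < 1 - r := by linarith
  have hmaps : ∀ p ∈ S, p.length ∈ Finset.range N := fun p hp => by
    rw [hS, Finset.mem_filter, SimpleGraph.mem_finsetWalkLengthLT_iff] at hp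
    exact Finset.mem_range.2 hp.1
  rw [← Finset.sum_fiberwise_of_maps_to hmaps]
  have hfib : ∀ ℓ ∈ Finset.range N, ∑ p ∈ S with p.length = ℓ, t ^ p.length ≤ if D ≤ ℓ then A * r ^ ℓ else 0 := by
    intro ℓ _
    have heq : ∑ p ∈ S with p.length = ℓ, t ^ p.length = ((S.filter fun p => p.length = ℓ).card : ℝ) * t ^ ℓ := by
      rw [Finset.sum_congr rfl (g := fun _ => t ^ ℓ) (fun p hp => by rw [(Finset.mem_filter.1 hp).2]), Finset.sum_const, nsmul_eq_mul]
    rw [heq]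
    split_ifs with hDl
    · have hsub : (S.filter fun p => p.length = ℓ) ⊆ ((layerGraph i H).finsetWalkLength ℓ a z).filter (fun p => p.IsPath) := by
        intro p hp
        simp only [hS, Finset.mem_filter, SimpleGraph.mem_finsetWalkLengthLT_iff, SimpleGraph.mem_finsetWalkLength_iff] at hp ⊢
        exact ⟨hp.2, hp.1.2⟩
      calc ((S.filter fun p => p.length = ℓ).card : ℝ) * t ^ ℓ ≤ (count n ℓ : ℝ) * t ^ ℓ := by
            gcongr
            exact_mod_cast (Finset.card_le_card hsub).trans (card_layerPaths_le_count hn i H a z ℓ)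
        _ ≤ A * lam ^ ℓ * t ^ ℓ := by gcongr; exact hcount ℓ
        _ = A * r ^ ℓ := by rw [hrdef, mul_pow]; ring
    · have hempty : (S.filter fun p => p.length = ℓ) = ∅ := by
        rw [Finset.filter_eq_empty_iff]
        intro p _ hpl
        have := height_le_length (jDist j z) (fun y y' h => jDist_le_of_adj j z h) p (jDist_self j z)
        omega
      rw [hempty, Finset.card_empty, Nat.cast_zero, zero_mul]
  refine (Finset.sum_le_sum hfib).trans ?_
  rw [← Finset.sum_filter]
  have hIco : (Finset.range N).filter (fun ℓ => D ≤ ℓ) = Finset.Ico D N := by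
    ext ℓ
    simp only [Finset.mem_filter, Finset.mem_range, Finset.mem_Ico]
    exact and_comm
  rw [hIco, Finset.sum_Ico_eq_sum_range]
  have hgeom : ∑ k ∈ Finset.range (N - D), r ^ k ≤ (1 - r)⁻¹ :=
    sum_le_hasSum _ (fun k _ => pow_nonneg hr0 k) (hasSum_geometric_of_lt_one hr0 (by linarith))
  calc ∑ k ∈ Finset.range (N - D), A * r ^ (D + k) = A * r ^ D * ∑ k ∈ Finset.range (N - D), r ^ k := by
        rw [Finset.mul_sum]
        exact Finset.sum_congr rfl fun k _ => by rw [pow_add]; ring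
    _ ≤ A * r ^ D * (1 - r)⁻¹ := mul_le_mul_of_nonneg_left hgeom (mul_nonneg hA (pow_nonneg hr0 _))
    _ = A * r ^ D / (1 - r) := by rw [div_eq_mul_inv]

/-! ### Counting certificates of `ℤⁿ` available in the tree -/

/-- `c_ℓ(ℤⁿ) ≤ (2n/(2n−1))·(2n−1)^ℓ` for `n ≥ 1` (walks without immediate reversals; tree `count_succ_le`). [cite: MadrasSlade1993, §1.2, eq. (1.2.2)] -/
theorem count_le_nonreversing (hn : 1 ≤ n) (ℓ : ℕ) :
    (count n ℓ : ℝ) ≤ ((2 * n : ℕ) : ℝ) / (((2 * n : ℕ) : ℝ) - 1) * ((((2 * n : ℕ) : ℝ) - 1)) ^ ℓ := by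
  have h2n : (2 : ℝ) ≤ ((2 * n : ℕ) : ℝ) := by exact_mod_cast (show 2 ≤ 2 * n by omega)
  have hpos : (0 : ℝ) < ((2 * n : ℕ) : ℝ) - 1 := by linarith
  rcases ℓ with _ | m
  · rw [Literature.Probability.RandomPlanarGeometry.SAW.Zd.count_zero, pow_zero, mul_one, Nat.cast_one, le_div_iff₀ hpos]
    linarith
  · have h := Literature.Probability.RandomPlanarGeometry.SAW.Zd.count_succ_le n m
    have hcast : (count n (m + 1) : ℝ) ≤ ((2 * n : ℕ) : ℝ) * ((((2 * n : ℕ) : ℝ) - 1)) ^ m := by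
      have h' : ((count n (m + 1) : ℕ) : ℝ) ≤ ((2 * n * (2 * n - 1) ^ m : ℕ) : ℝ) := by exact_mod_cast h
      have hsub : (((2 * n - 1 : ℕ)) : ℝ) = ((2 * n : ℕ) : ℝ) - 1 := by
        rw [Nat.cast_sub (by omega)]; push_cast; ring
      rw [Nat.cast_mul, Nat.cast_pow, hsub] at h'
      exact h'
    refine hcast.trans (le_of_eq ?_)
    rw [pow_succ]
    field_simp

end ZTwo

end Summit.Ventures.YMGap.RobustBall

end
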